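import Mathlib

/-!
# Two-mode telescoping glue
(stub `twoMode_glue` of line `Sketch`, crux stmt-AtomisticToContinuum-12111 `PuiseuxTransferLedger.TwoModeBulk`)

Pure real analysis, no oscillator chain in sight. For a family of profiles `u N : Fin (N+1) → ℝ` (one per chain
length) and per-bond scales `g N`:

* LAYER RELAXATION — the SECOND differences of `u N` decay geometrically from both ends with amplitude `O(|g N|)`,
  `|u N i - 2 u N (i+1) + u N (i+2)| ≤ C |g N| (θ^i + θ^(N-2-i))`, rate `θ ∈ [0,1)` and constant independent of `N`;
* BULK SLOPE — at the middle bond `m = N/2` the increment is `r · g N` up to `O(|g N| θ^N)`;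

together give the TWO-MODE form of EVERY increment, with constants independent of `N`:
`|u N i - u N (i+1) - r · g N| ≤ C' |g N| (θ'^i + θ'^(N-1-i))` (`θ' = max θ_L θ_B`,
`C' = max C_B 0 + 2 max C_L 0 / (1 - θ')`). Proof: telescope the increments from the middle bond to the bond
`(i, i+1)`; the differences of consecutive increments are the second differences, whose two geometric tails sum to
`≤ 2 max C_L 0 |g N| θ'^i/(1-θ')` on the left half (resp. `θ'^(N-1-i)` on the right half), and `θ'^N ≤ θ'^i`.
No definitions.
-/

namespace Summit.AtomisticToContinuum.FouriersLaw.Theorems.TwoModeBulk.Sketch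

open Finset

/-- Reversed geometric sum over an interval: `∑_{k ∈ [a,b)} θ^(n-k) ≤ θ^(n+1-b)/(1-θ)` for `b ≤ n + 1`,
`0 ≤ θ < 1`. [folklore] -/
theorem geom_sum_Ico_rev_le {θ : ℝ} (h0 : 0 ≤ θ) (h1 : θ < 1) {a b n : ℕ} (hb : b ≤ n + 1) :
    ∑ k ∈ Finset.Ico a b, θ ^ (n - k) ≤ θ ^ (n + 1 - b) / (1 - θ) := by
  rw [Finset.sum_Ico_reflect (fun j => θ ^ j) a hb]
  exact geom_sum_Ico_le_of_lt_one h0 h1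

/-- Telescoping of increments over an interval: `∑_{k ∈ [i,m)} (Δ k - Δ (k+1)) = Δ i - Δ m` for `i ≤ m`.
[folklore] -/
theorem sum_Ico_sub_succ (Δ : ℕ → ℝ) {i m : ℕ} (him : i ≤ m) :
    ∑ k ∈ Finset.Ico i m, (Δ k - Δ (k + 1)) = Δ i - Δ m := by
  rw [Finset.sum_Ico_eq_sum_range]
  have h := Finset.sum_range_sub' (fun k => Δ (i + k)) (m - i)
  simp only [add_zero, Nat.add_sub_cancel' him] at h
  rw [← h]
  refine Finset.sum_congr rfl fun k _ => ?_
  rw [add_assoc]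

/-- **Two-mode glue at one chain length.** For a sequence `u : ℕ → ℝ`: layer relaxation (geometric decay of the
second differences from both ends of `[0, N]`, amplitude `|g|`) and an exponentially accurate slope `r g` at the
middle bond `N/2` give the two-mode form of every increment `u i - u (i+1)`, `i + 1 ≤ N`, with the explicit
constant `max C' 0 + 2 max C 0 / (1 - θ)`. [folklore] -/
theorem twoMode_of_layer_and_slope {θ C C' r g : ℝ} (h0 : 0 ≤ θ) (h1 : θ < 1) {N : ℕ} {u : ℕ → ℝ}
    (hL : ∀ i : ℕ, i + 2 ≤ N → |u i - 2 * u (i + 1) + u (i + 2)| ≤ C * |g| * (θ ^ i + θ ^ (N - 2 - i)))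
    (hB : 1 ≤ N → |u (N / 2) - u (N / 2 + 1) - r * g| ≤ C' * |g| * θ ^ N) :
    ∀ i : ℕ, i + 1 ≤ N →
      |u i - u (i + 1) - r * g| ≤ (max C' 0 + 2 * max C 0 / (1 - θ)) * |g| * (θ ^ i + θ ^ (N - 1 - i)) := by
  intro i hi
  set m := N / 2 with hm
  have hN : 1 ≤ N := by omega
  have h1θ : 0 < 1 - θ := by linarith
  have hg : 0 ≤ |g| := abs_nonneg g
  have hC : C ≤ max C 0 := le_max_left _ _
  have hC0 : 0 ≤ max C 0 := le_max_right _ _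
  have hC' : C' ≤ max C' 0 := le_max_left _ _
  have hC'0 : 0 ≤ max C' 0 := le_max_right _ _
  -- increments and their differences
  set Δ : ℕ → ℝ := fun k => u k - u (k + 1) with hΔ
  have hΔΔ : ∀ k : ℕ, k + 2 ≤ N → |Δ k - Δ (k + 1)| ≤ max C 0 * |g| * (θ ^ k + θ ^ (N - 2 - k)) := by
    intro k hk
    have e : Δ k - Δ (k + 1) = u k - 2 * u (k + 1) + u (k + 2) := by simp only [hΔ]; ring
    rw [e]
    exact (hL k hk).trans (by gcongr)
  have hBm : |Δ m - r * g| ≤ max C' 0 * |g| * θ ^ N := (hB hN).trans (by gcongr)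
  have hθpow : ∀ {a b : ℕ}, a ≤ b → θ ^ b ≤ θ ^ a := fun hab => pow_le_pow_of_le_one h0 h1.le hab
  have hθi : 0 ≤ θ ^ i := pow_nonneg h0 _
  have hθi' : 0 ≤ θ ^ (N - 1 - i) := pow_nonneg h0 _
  -- the key one-sided estimates
  have hK : 0 ≤ (max C' 0 + 2 * max C 0 / (1 - θ)) * |g| := by positivity
  rcases lt_trichotomy i m with him | rfl | hmi
  · -- left half: telescope from `i` to `m`
    have htel : Δ i - Δ m = ∑ k ∈ Finset.Ico i m, (Δ k - Δ (k + 1)) := (sum_Ico_sub_succ Δ him.le).symm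
    have hsum : |Δ i - Δ m| ≤ max C 0 * |g| * (θ ^ i / (1 - θ) + θ ^ i / (1 - θ)) := by
      rw [htel]
      refine (Finset.abs_sum_le_sum_abs _ _).trans ?_
      have hterm : ∀ k ∈ Finset.Ico i m, |Δ k - Δ (k + 1)| ≤ max C 0 * |g| * (θ ^ k + θ ^ (N - 2 - k)) := by
        intro k hk
        have hk' := (Finset.mem_Ico.mp hk).2
        exact hΔΔ k (by omega)
      refine (Finset.sum_le_sum hterm).trans ?_
      rw [← Finset.mul_sum, Finset.sum_add_distrib]
      have hA : ∑ k ∈ Finset.Ico i m, θ ^ k ≤ θ ^ i / (1 - θ) := geom_sum_Ico_le_of_lt_one h0 h1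
      have hB' : ∑ k ∈ Finset.Ico i m, θ ^ (N - 2 - k) ≤ θ ^ i / (1 - θ) :=
        calc ∑ k ∈ Finset.Ico i m, θ ^ (N - 2 - k) ≤ θ ^ (N - 2 + 1 - m) / (1 - θ) :=
              geom_sum_Ico_rev_le h0 h1 (by omega)
          _ ≤ θ ^ i / (1 - θ) := div_le_div_of_nonneg_right (hθpow (by omega)) h1θ.le
      have hmul : 0 ≤ max C 0 * |g| := by positivity
      exact mul_le_mul_of_nonneg_left (add_le_add hA hB') hmul
    have hθN : θ ^ N ≤ θ ^ i := hθpow (by omega)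
    calc |u i - u (i + 1) - r * g| = |(Δ i - Δ m) + (Δ m - r * g)| := by simp only [hΔ]; ring_nf
      _ ≤ |Δ i - Δ m| + |Δ m - r * g| := abs_add_le _ _
      _ ≤ max C 0 * |g| * (θ ^ i / (1 - θ) + θ ^ i / (1 - θ)) + max C' 0 * |g| * θ ^ N := add_le_add hsum hBm
      _ ≤ max C 0 * |g| * (θ ^ i / (1 - θ) + θ ^ i / (1 - θ)) + max C' 0 * |g| * θ ^ i := by gcongr
      _ = (max C' 0 + 2 * max C 0 / (1 - θ)) * |g| * θ ^ i := by field_simp; ring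
      _ ≤ (max C' 0 + 2 * max C 0 / (1 - θ)) * |g| * (θ ^ i + θ ^ (N - 1 - i)) := by nlinarith
  · -- the middle bond itself
    have hθN : θ ^ N ≤ θ ^ m := hθpow (by omega)
    calc |u m - u (m + 1) - r * g| = |Δ m - r * g| := by simp only [hΔ]
      _ ≤ max C' 0 * |g| * θ ^ N := hBm
      _ ≤ max C' 0 * |g| * θ ^ m := by gcongr
      _ ≤ (max C' 0 + 2 * max C 0 / (1 - θ)) * |g| * θ ^ m := by
          have hθm : 0 ≤ θ ^ m := pow_nonneg h0 _
          have : max C' 0 * |g| ≤ (max C' 0 + 2 * max C 0 / (1 - θ)) * |g| := by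
            apply mul_le_mul_of_nonneg_right _ hg
            have : 0 ≤ 2 * max C 0 / (1 - θ) := by positivity
            linarith
          exact mul_le_mul_of_nonneg_right this hθm
      _ ≤ (max C' 0 + 2 * max C 0 / (1 - θ)) * |g| * (θ ^ m + θ ^ (N - 1 - m)) := by nlinarith
  · -- right half: telescope from `m` to `i`
    have htel : Δ m - Δ i = ∑ k ∈ Finset.Ico m i, (Δ k - Δ (k + 1)) := (sum_Ico_sub_succ Δ hmi.le).symm
    have hsum : |Δ m - Δ i| ≤ max C 0 * |g| * (θ ^ (N - 1 - i) / (1 - θ) + θ ^ (N - 1 - i) / (1 - θ)) := by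
      rw [htel]
      refine (Finset.abs_sum_le_sum_abs _ _).trans ?_
      have hterm : ∀ k ∈ Finset.Ico m i, |Δ k - Δ (k + 1)| ≤ max C 0 * |g| * (θ ^ k + θ ^ (N - 2 - k)) := by
        intro k hk
        have hk' := (Finset.mem_Ico.mp hk).2
        exact hΔΔ k (by omega)
      refine (Finset.sum_le_sum hterm).trans ?_
      rw [← Finset.mul_sum, Finset.sum_add_distrib]
      have hA : ∑ k ∈ Finset.Ico m i, θ ^ k ≤ θ ^ (N - 1 - i) / (1 - θ) :=
        calc ∑ k ∈ Finset.Ico m i, θ ^ k ≤ θ ^ m / (1 - θ) := geom_sum_Ico_le_of_lt_one h0 h1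
          _ ≤ θ ^ (N - 1 - i) / (1 - θ) := div_le_div_of_nonneg_right (hθpow (by omega)) h1θ.le
      have hB' : ∑ k ∈ Finset.Ico m i, θ ^ (N - 2 - k) ≤ θ ^ (N - 1 - i) / (1 - θ) :=
        calc ∑ k ∈ Finset.Ico m i, θ ^ (N - 2 - k) ≤ θ ^ (N - 2 + 1 - i) / (1 - θ) :=
              geom_sum_Ico_rev_le h0 h1 (by omega)
          _ ≤ θ ^ (N - 1 - i) / (1 - θ) := div_le_div_of_nonneg_right (hθpow (by omega)) h1θ.le
      have hmul : 0 ≤ max C 0 * |g| := by positivity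
      exact mul_le_mul_of_nonneg_left (add_le_add hA hB') hmul
    have hθN : θ ^ N ≤ θ ^ (N - 1 - i) := hθpow (by omega)
    calc |u i - u (i + 1) - r * g| = |(Δ m - r * g) - (Δ m - Δ i)| := by simp only [hΔ]; ring_nf
      _ ≤ |Δ m - r * g| + |Δ m - Δ i| := abs_sub _ _
      _ ≤ max C' 0 * |g| * θ ^ N +
          max C 0 * |g| * (θ ^ (N - 1 - i) / (1 - θ) + θ ^ (N - 1 - i) / (1 - θ)) := add_le_add hBm hsum
      _ ≤ max C' 0 * |g| * θ ^ (N - 1 - i) +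
          max C 0 * |g| * (θ ^ (N - 1 - i) / (1 - θ) + θ ^ (N - 1 - i) / (1 - θ)) := by gcongr
      _ = (max C' 0 + 2 * max C 0 / (1 - θ)) * |g| * θ ^ (N - 1 - i) := by field_simp; ring
      _ ≤ (max C' 0 + 2 * max C 0 / (1 - θ)) * |g| * (θ ^ i + θ ^ (N - 1 - i)) := by nlinarith

/-- **STUB `twoMode_glue` of line `Sketch` (crux `PuiseuxTransferLedger.TwoModeBulk`): the `N`-uniform two-mode
glue.** For a family of profiles `u N : Fin (N+1) → ℝ` and scales `g N`: if the second differences of `u N` decay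
geometrically from both contacts with amplitude `O(|g N|)` (layer relaxation, constants independent of `N`) and the
increment at the middle bond `(N/2, N/2+1)` is `r · g N` up to `O(|g N| θ^N)` (bulk slope), then EVERY increment is
`r · g N` up to `C |g N| (θ^i + θ^(N-1-i))` with `(r, θ, C)` independent of `N`
(`θ = max θ_L θ_B`, `C = max C_B 0 + 2 max C_L 0/(1-θ)`; telescoping from the middle bond, `twoMode_of_layer_and_slope`
applied to `n ↦ u N ⟨n, _⟩` extended by `0`). [folklore] -/
theorem twoMode_glue : ∀ (u : (N : ℕ) → Fin (N + 1) → ℝ) (g : ℕ → ℝ), (∃ θ C : ℝ, 0 ≤ θ ∧ θ < 1 ∧ ∀ (N : ℕ) (i j k : Fin (N + 1)), j.val = i.val + 1 → k.val = i.val + 2 → |u N i - 2 * u N j + u N k| ≤ C * |g N| * (θ ^ i.val + θ ^ (N - 2 - i.val))) → (∃ r θ C : ℝ, 0 ≤ θ ∧ θ < 1 ∧ ∀ (N : ℕ) (i j : Fin (N + 1)), i.val = N / 2 → j.val = i.val + 1 → |u N i - u N j - r * g N| ≤ C * |g N| * θ ^ N) → ∃ r θ C : ℝ, 0 ≤ θ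 ∧ θ < 1 ∧ ∀ (N : ℕ) (i j : Fin (N + 1)), j.val = i.val + 1 → |u N i - u N j - r * g N| ≤ C * |g N| * (θ ^ i.val + θ ^ (N - 1 - i.val)) := by
  intro u g hL hB
  obtain ⟨θ₁, C₁, h01, h11, hL'⟩ := hL
  obtain ⟨r, θ₂, C₂, h02, h12, hB'⟩ := hB
  set θ := max θ₁ θ₂ with hθ
  have h0 : 0 ≤ θ := le_max_of_le_left h01
  have h1 : θ < 1 := max_lt h11 h12
  have hθ₁ : ∀ n : ℕ, θ₁ ^ n ≤ θ ^ n := fun n => pow_le_pow_left₀ h01 (le_max_left _ _) n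
  have hθ₂ : ∀ n : ℕ, θ₂ ^ n ≤ θ ^ n := fun n => pow_le_pow_left₀ h02 (le_max_right _ _) n
  refine ⟨r, θ, max C₂ 0 + 2 * max C₁ 0 / (1 - θ), h0, h1, ?_⟩
  intro N i j hij
  -- the profile at length `N` as a sequence on `ℕ` (junk `0` beyond the chain)
  set v : ℕ → ℝ := fun n => if h : n < N + 1 then u N ⟨n, h⟩ else 0 with hv
  have hv_apply' : ∀ (n : ℕ) (h : n < N + 1), v n = u N ⟨n, h⟩ := fun n h => by
    simp only [hv, dif_pos h]
  have hv_apply : ∀ k : Fin (N + 1), v k.val = u N k := fun k => hv_apply' k.val k.isLt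
  have hgn : 0 ≤ |g N| := abs_nonneg _
  -- layer relaxation for `v`
  have hLv : ∀ n : ℕ, n + 2 ≤ N →
      |v n - 2 * v (n + 1) + v (n + 2)| ≤ max C₁ 0 * |g N| * (θ ^ n + θ ^ (N - 2 - n)) := by
    intro n hn
    have h : |u N ⟨n, by omega⟩ - 2 * u N ⟨n + 1, by omega⟩ + u N ⟨n + 2, by omega⟩| ≤
        C₁ * |g N| * (θ₁ ^ n + θ₁ ^ (N - 2 - n)) :=
      hL' N ⟨n, by omega⟩ ⟨n + 1, by omega⟩ ⟨n + 2, by omega⟩ rfl rfl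
    rw [hv_apply' n (by omega), hv_apply' (n + 1) (by omega), hv_apply' (n + 2) (by omega)]
    refine h.trans ?_
    have hS : 0 ≤ θ₁ ^ n + θ₁ ^ (N - 2 - n) := add_nonneg (pow_nonneg h01 _) (pow_nonneg h01 _)
    calc C₁ * |g N| * (θ₁ ^ n + θ₁ ^ (N - 2 - n)) ≤ max C₁ 0 * |g N| * (θ₁ ^ n + θ₁ ^ (N - 2 - n)) :=
          mul_le_mul_of_nonneg_right (mul_le_mul_of_nonneg_right (le_max_left _ _) hgn) hS
      _ ≤ max C₁ 0 * |g N| * (θ ^ n + θ ^ (N - 2 - n)) :=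
          mul_le_mul_of_nonneg_left (add_le_add (hθ₁ _) (hθ₁ _)) (by positivity)
  -- bulk slope for `v`
  have hBv : 1 ≤ N → |v (N / 2) - v (N / 2 + 1) - r * g N| ≤ max C₂ 0 * |g N| * θ ^ N := by
    intro hN
    have h : |u N ⟨N / 2, by omega⟩ - u N ⟨N / 2 + 1, by omega⟩ - r * g N| ≤ C₂ * |g N| * θ₂ ^ N :=
      hB' N ⟨N / 2, by omega⟩ ⟨N / 2 + 1, by omega⟩ rfl rfl
    rw [hv_apply' (N / 2) (by omega), hv_apply' (N / 2 + 1) (by omega)]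
    refine h.trans ?_
    calc C₂ * |g N| * θ₂ ^ N ≤ max C₂ 0 * |g N| * θ₂ ^ N :=
          mul_le_mul_of_nonneg_right (mul_le_mul_of_nonneg_right (le_max_left _ _) hgn) (pow_nonneg h02 _)
      _ ≤ max C₂ 0 * |g N| * θ ^ N := mul_le_mul_of_nonneg_left (hθ₂ _) (by positivity)
  -- glue, at the bond `(i, j)`
  have hi : i.val + 1 ≤ N := by have := j.isLt; omega
  have hglue := twoMode_of_layer_and_slope h0 h1 hLv hBv i.val hi
  have e1 : v i.val = u N i := hv_apply i
  have e2 : v (i.val + 1) = u N j := by rw [← hij]; exact hv_apply j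
  rw [e1, e2, max_eq_left (le_max_right C₂ 0), max_eq_left (le_max_right C₁ 0)] at hglue
  exact hglue

end Summit.AtomisticToContinuum.FouriersLaw.Theorems.TwoModeBulk.Sketch
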